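import Literature.NumberTheory.GaloisCohomology.BrauerHassePrinciple
import Literature.NumberTheory.GaloisRepresentations.BrauerHassePrinciple
import HarnessLib

/-!
# The Hasse principle for the Brauer group of a number field: the discharge

`Proofs`-style sibling (theorems only: no definition, no named fact, no instance; D-0026) of
`Literature/NumberTheory/GaloisCohomology/BrauerHassePrinciple.lean`, closing its named fact
`Literature.NumberTheory.GaloisCohomology.brauerHassePrinciple K` (Brauer–Hasse–Noether, the
injectivity of `Br K → ⊕_{v ∈ Ω_K} Br K_v` in cochain form; Harari, *Galois Cohomology and Class
Field Theory*, Thm. 14.11, first half) for every number field `K`.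

The proof is the tree's theorem
`Literature.NumberTheory.GaloisRepresentations.twoCocycle_cob_of_locallyTrivial`
(`Literature/NumberTheory/GaloisRepresentations/BrauerHassePrinciple.lean`: Cassels–Fröhlich,
Ch. VII (Tate) §9.6 — the Hasse principle for a cyclic layer from Hasse's norm theorem — and §10 —
reduction to cyclic layers by `inf`–`res` in the tower, Sylow subgroups and a cyclic quotient of a
`p`-group), which is stated for unit-valued cocycles `e : Γ_K × Γ_K → K̄ˣ`; the named fact speaks of
`K̄`-valued pointwise non-zero cocycles (the format of its consumers), and this file performs that
packaging (`Units.mk0`), exactly as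
`Literature.NumberTheory.EllipticCurves.hassePrinciple_twoCocycle` does in the `closureEmb`/`resGal`
dialect (`closureEmb = absClosureEmbedding`, `resGal = absGaloisRestrict` definitionally).

Consumers unblocked: Tate's theorem `H²(G_ℚ, ℚ/ℤ) = 0` and the lifting of projective
representations of `G_ℚ` (`Tate_projectiveLifting_of_brauerHassePrinciple'`,
`Literature/NumberTheory/GaloisRepresentations/TateLevelOneTwo.lean`; Serre, Durham 1977, §6.5 (c)).

## References

* D. Harari, *Galois Cohomology and Class Field Theory*, Universitext, Springer 2020, Thm. 14.11
  (Brauer–Hasse–Noether) and Def. 6.8. [Harari2020]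
* J. W. S. Cassels, A. Fröhlich (eds.), *Algebraic Number Theory* (1967), Ch. VII (J. Tate),
  §9.6 (Hasse norm theorem and the cyclic Hasse principle), §10. [CasselsFrohlichANT1967]
* J. Neukirch, A. Schmidt, K. Wingberg, *Cohomology of Number Fields*, 2nd ed. (2008),
  Thm. (8.1.17). [NeukirchSchmidtWingberg2008]
-/

noncomputable section

open NumberField IsDedekindDomain Field

universe u

namespace Literature.NumberTheory.GaloisCohomology

open Literature.NumberTheory.GaloisRepresentations

/-- **The Hasse principle for the Brauer group of a number field holds** (Brauer–Hasse–Noether;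
Harari, Thm. 14.11, first half: `Br K → ⊕_{v ∈ Ω_K} Br K_v` is injective), discharge of the named
fact `brauerHassePrinciple K` for every number field `K`: a locally constant pointwise non-zero
`2`-cocycle `e : Γ_K × Γ_K → K̄` which is the coboundary of a locally constant nowhere-zero cochain
over every completion `K_v` (finite `v`) and `K_w` (infinite `w`) is such a coboundary over `K`.
Proof: pass to the unit-valued cocycle `σ τ ↦ Units.mk0 (e σ τ) _` and apply
`twoCocycle_cob_of_locallyTrivial` (Cassels–Fröhlich Ch. VII §9.6, §10, proved in the tree from
Hasse's norm theorem for cyclic extensions).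
[cite: Harari2020, Thm. 14.11] [cite: CasselsFrohlichANT1967, Ch. VII §9.6 and §10] -/
theorem brauerHassePrinciple_holds :
    ∀ (K : Type u) [Field K] [NumberField K], brauerHassePrinciple K := by
  intro K _ _ e hlc he0 hcoc hfin hinf
  -- the unit-valued cocycle
  set eU : absoluteGaloisGroup K → absoluteGaloisGroup K → (AlgebraicClosure K)ˣ :=
    fun σ τ => Units.mk0 (e σ τ) (he0 σ τ) with heU
  have hvalU : ∀ σ τ, ((eU σ τ : (AlgebraicClosure K)ˣ) : AlgebraicClosure K) = e σ τ :=
    fun σ τ => rfl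
  have hlcU : IsLocallyConstant
      (fun p : absoluteGaloisGroup K × absoluteGaloisGroup K => eU p.1 p.2) :=
    IsLocallyConstant.desc _ (Units.val : (AlgebraicClosure K)ˣ → AlgebraicClosure K) hlc
      Units.val_injective
  have hcocU : ∀ σ τ υ, eU σ τ * eU (σ * τ) υ = σ • eU τ υ * eU σ (τ * υ) := fun σ τ υ =>
    Units.ext (by
      rw [Units.val_mul, Units.val_mul, Units.coe_smul, hvalU, hvalU, hvalU, hvalU]
      exact hcoc σ τ υ)
  -- local triviality in unit form, finite places
  have hfinU : ∀ v : HeightOneSpectrum (𝓞 K),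
      ∃ b : absoluteGaloisGroup (v.adicCompletion K) → (AlgebraicClosure (v.adicCompletion K))ˣ,
        IsLocallyConstant b ∧ ∀ x y,
          Units.map (absClosureEmbedding K (v.adicCompletion K) :
              AlgebraicClosure K →* AlgebraicClosure (v.adicCompletion K))
            (eU (absGaloisRestrict K (v.adicCompletion K) x)
              (absGaloisRestrict K (v.adicCompletion K) y)) =
          b x * x • b y / b (x * y) := fun v => by
    obtain ⟨b, hb, hb0, hbe⟩ := hfin v
    refine ⟨fun x => Units.mk0 (b x) (hb0 x),
      IsLocallyConstant.desc _ (Units.val : (AlgebraicClosure (v.adicCompletion K))ˣ → _) hb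
        Units.val_injective,
      fun x y => Units.ext ?_⟩
    rw [Units.val_div_eq_div_val, Units.val_mul, Units.coe_smul, Units.coe_map,
      MonoidHom.coe_coe, hvalU]
    exact hbe x y
  -- local triviality in unit form, infinite places
  have hinfU : ∀ w : InfinitePlace K,
      ∃ b : absoluteGaloisGroup w.Completion → (AlgebraicClosure w.Completion)ˣ,
        IsLocallyConstant b ∧ ∀ x y,
          Units.map (absClosureEmbedding K w.Completion :
              AlgebraicClosure K →* AlgebraicClosure w.Completion)
            (eU (absGaloisRestrict K w.Completion x) (absGaloisRestrict K w.Completion y)) =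
          b x * x • b y / b (x * y) := fun w => by
    obtain ⟨b, hb, hb0, hbe⟩ := hinf w
    refine ⟨fun x => Units.mk0 (b x) (hb0 x),
      IsLocallyConstant.desc _ (Units.val : (AlgebraicClosure w.Completion)ˣ → _) hb
        Units.val_injective,
      fun x y => Units.ext ?_⟩
    rw [Units.val_div_eq_div_val, Units.val_mul, Units.coe_smul, Units.coe_map,
      MonoidHom.coe_coe, hvalU]
    exact hbe x y
  -- the Hasse principle for `H²(K, K̄ˣ)`
  obtain ⟨bU, hbU, hbUe⟩ := twoCocycle_cob_of_locallyTrivial eU hlcU hcocU hfinU hinfU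
  refine ⟨fun σ => (bU σ : AlgebraicClosure K), hbU.comp _, fun σ => (bU σ).ne_zero,
    fun σ τ => ?_⟩
  rw [← hvalU, hbUe, Units.val_div_eq_div_val, Units.val_mul, Units.coe_smul]

end Literature.NumberTheory.GaloisCohomology

end
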